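import Summits.Ventures.HSemireg.WedgeHankelSecantKernel
import Summits.Ventures.HSemireg.WedgeHankelSiegelIdealKernel

/-!
# Venture HSemireg — THE SIEGEL IDEAL IS THE INTERSECTION OF ANY `k+1` FRAME IDEALS: `SI_k = ⋂_{i ≤ k} F_{λ_i}(k)` (`2k ≤ m`),
# and the kernel of every secant class with MORE THAN `k` NODES is `SI_k`

HONEST FRAMING. Part of the Lean index of the computation cell `pub-hsemireg` (seat p10 gen 14, Sunday typer «UNIFORM-IN-n»).
Finite-dimensional EXTERIOR ALGEBRA over a field and ranks of HANKEL MATRICES ONLY: no variety, no cohomology theory, no sheaf, no Ext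
group and no semiregularity map is constructed here; nothing here says that HC / HC_CM / HC_AV holds; no Literature fact is declared or
used.  Custodian versions cited: theory/FORMULA-N.md PART A §2.6 THEOREM H / FN-4 (i) («with v-independent kernel the Θ-isotropic part»);
STRUCTURE.md v1.0-SIGNED 9b196a05977dd067 §1.1 C15.  The dictionary (`Σ_i A_i exp(λ_i Θ)` ↦ `q_j = Σ_i A_i λ_i^j` ↦ `w_m(q)`;
`⌟v` on `HT^k` ↦ `θ ↦ θ ∧ w_m(q)` on `⋀^k K^{2m}`) is QUOTED, never asserted.

WHAT IS KEYED.  Gen 11 (`WedgeHankelSiegelIdeal*`): the SIEGEL IDEAL `SI_k` — the `q`-INDEPENDENT part of the kernel, `dim SI_k + (k+1)·C(m,k)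
= C(2m,k)`, `ker = SI_k ⟺ rank H_k(q) = k + 1`, and `SI_k = ⋂_q ker` for `2k ≤ m` (tested on the single power `E_k`).  Gen 14 D1/D2: the
secant rank law `rank H_k(Σ_{i<r} A_i λ_i^•) = min(r, k+1)` (`r ≤ m+1−k`) and THE SECANT KERNEL LAW `Kr = ⋂_{i<r} F_{λ_i}(k)` (`r ≤ k+1`).
THIS FILE joins them:
* §1 **`siegelIdeal_le_Kr_w`**: `SI_k ≤ Kr(univ, w_m(q), k)` for every class (gen 11's `mul_w_eq_zero_of_mem_siegelIdeal`, in C1's `Kr` language);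
  hence **`siegelIdeal_le_frameIdeal`: `SI_k ≤ F_λ(k)` for every slope** and `SI_k ≤ Σ_a y_a ∧ Hom(univ,k−1)` (the point, slope `∞`).
* §2 **`Kr_w_secSeq_eq_siegelIdeal`: for `k + 1 ≤ r ≤ m + 1 − k` distinct slopes and non-zero weights, `Kr(univ, w_m(Σ_{i<r} A_i λ_i^•), k)
  = SI_k`** — a secant class with more than `k` nodes is GENERIC in degree `k` (D1's full rank + gen 11's criterion, via C1's rank–nullity).
* §3 **THE SIEGEL IDEAL AS AN INTERSECTION OF FRAMES — `iInf_frameIdeal_eq_siegelIdeal`: for `1 ≤ k`, `2k ≤ m` and ANY `r ≥ k + 1` distinct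
  slopes, `⋂_{i<r} F_{λ_i}(k) = SI_k`**: the degree-`k` forms killing `k + 1` exponentials of distinct slopes kill EVERY class
  (`mul_w_eq_zero_of_forall_uprod`), and they are exactly the Siegel ideal.  (`k = 1`: two frames already meet trivially — `SI_1 = 0`.)
Namespace `Summit.Ventures.HSemireg.Wedge.HankelSecant` (continued); new names only.
-/

open Module

namespace Summit.Ventures.HSemireg.Wedge.HankelSecant

open Summit.Ventures.HSemireg.Wedge Summit.Ventures.HSemireg.Wedge.Kunneth Summit.Ventures.HSemireg.Wedge.KunnethKernel
  Summit.Ventures.HSemireg.Wedge.HankelFaces Summit.Ventures.HSemireg.Wedge.HankelPureKernel Summit.Ventures.HSemireg.Wedge.HankelSiegelIdeal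

variable (K : Type*) [Field K] (m : ℕ)

/-! ## §1. The Siegel ideal lies in every kernel -/

/-- **`SI_k ≤ Kr(univ, w_m(q), k)` for EVERY coefficient sequence `q`** (gen 11: every generator of the Siegel ideal kills every class). -/
theorem siegelIdeal_le_Kr_w (k : ℕ) (q : ℕ → K) : siegelIdeal K m k ≤ Kr K Finset.univ (Hankel.w K m m q) k := by
  intro θ hθ
  refine mem_Kr.mpr ⟨?_, mul_w_eq_zero_of_mem_siegelIdeal K hθ q⟩
  rw [Hom_univ_eq_exteriorPower]
  exact siegelIdeal_le_exteriorPower K k hθ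

/-- hence **`SI_k ≤ F_λ(k)`: the Siegel ideal lies in the frame ideal of every slope** (`k ≥ 1`; `F_λ(k)` = the kernel space of the pure class
of slope `λ`, C6). -/
theorem siegelIdeal_le_frameIdeal (lam : K) {k : ℕ} (hk : 1 ≤ k) : siegelIdeal K m k ≤ frameIdeal K m (uvec K m lam) k := by
  rw [← Kr_w_expSeq K m one_ne_zero lam hk]
  exact siegelIdeal_le_Kr_w K m k _

/-- … and in the frame ideal of the point (slope `∞`): **`SI_k ≤ Σ_a y_a ∧ Hom(univ, k−1)`** (`m ≥ 1`, `k ≥ 1`; C7's `Kr_w_point`). -/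
theorem siegelIdeal_le_frameIdeal_Y (hm : 1 ≤ m) {k : ℕ} (hk : 1 ≤ k) : siegelIdeal K m k ≤ frameIdeal K m (Hankel.Y K m) k := by
  rw [← Kr_w_point K m hm one_ne_zero hk]
  exact siegelIdeal_le_Kr_w K m k _

/-- so the Siegel ideal lies in every intersection of frame ideals. -/
theorem siegelIdeal_le_iInf_frameIdeal {r : ℕ} (lam : Fin r → K) {k : ℕ} (hk : 1 ≤ k) :
    siegelIdeal K m k ≤ ⨅ i, frameIdeal K m (uvec K m (lam i)) k :=
  le_iInf fun i => siegelIdeal_le_frameIdeal K m (lam i) hk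

/-! ## §2. Secant classes with more than `k` nodes are generic in degree `k` -/

/-- **`Kr(univ, w_m(Σ_{i<r} A_i λ_i^•), k) = SI_k` for `k + 1 ≤ r ≤ m + 1 − k`** (distinct slopes, non-zero weights, every field): the Hankel
matrix has full row rank (D1's `rank_hankel1_secSeq_of_le`), so the kernel is the `q`-independent Siegel ideal (containment §1 + equal numbers). -/
theorem Kr_w_secSeq_eq_siegelIdeal {r k : ℕ} (hkr : k + 1 ≤ r) (hrm : r ≤ m + 1 - k) {A lam : Fin r → K} (hA : ∀ i, A i ≠ 0)
    (hlam : Function.Injective lam) : Kr K Finset.univ (Hankel.w K m m (secSeq K A lam)) k = siegelIdeal K m k := by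
  refine (Submodule.eq_of_le_of_finrank_eq (siegelIdeal_le_Kr_w K m k _) ?_).symm
  have h1 := finrank_Kr_w_secSeq_add_of_le K m hkr hrm hA hlam
  have h2 := finrank_siegelIdeal K (n := m) k
  omega

/-- wedge form: **`ker(θ ↦ θ ∧ w_m(Σ_{i<r} A_i λ_i^•) ∣ ⋀^k) = SI_k`** (comapped) in the same range. -/
theorem ker_wedge_w_secSeq_eq_siegelIdeal {r k : ℕ} (hkr : k + 1 ≤ r) (hrm : r ≤ m + 1 - k) {A lam : Fin r → K} (hA : ∀ i, A i ≠ 0)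
    (hlam : Function.Injective lam) :
    LinearMap.ker (wedge K (Hankel.In m) k (Hankel.w K m m (secSeq K A lam))) = (siegelIdeal K m k).comap (⋀[K]^k (Hankel.In m → K)).subtype := by
  rw [ker_wedge_eq_comap_Kr, Kr_w_secSeq_eq_siegelIdeal K m hkr hrm hA hlam]

/-! ## §3. The Siegel ideal is the intersection of any `k + 1` frame ideals -/

/-- **`⋂_{i ≤ k} F_{λ_i}(k) = SI_k`** for EXACTLY `k + 1` distinct slopes, `1 ≤ k`, `2k ≤ m`: D2's secant kernel law at `r = k + 1` is §2's
generic kernel. -/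
theorem iInf_frameIdeal_eq_siegelIdeal_succ {k : ℕ} (hk : 1 ≤ k) (hkm : k + k ≤ m) {lam : Fin (k + 1) → K} (hlam : Function.Injective lam) :
    (⨅ i, frameIdeal K m (uvec K m (lam i)) k) = siegelIdeal K m k := by
  rw [← Kr_w_secSeq K m (Nat.succ_pos k) hk le_rfl (by omega) (A := fun _ => (1 : K)) (fun _ => one_ne_zero) hlam]
  exact Kr_w_secSeq_eq_siegelIdeal K m le_rfl (by omega) (fun _ => one_ne_zero) hlam

/-- **THE SIEGEL IDEAL AS AN INTERSECTION OF FRAMES: `⋂_{i<r} F_{λ_i}(k) = SI_k` for ANY `r ≥ k + 1` distinct slopes** (`1 ≤ k`, `2k ≤ m`;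
every field, `m`) — the intersection over the first `k + 1` slopes is already `SI_k`, which lies in every frame ideal. -/
theorem iInf_frameIdeal_eq_siegelIdeal {k : ℕ} (hk : 1 ≤ k) (hkm : k + k ≤ m) {r : ℕ} (hkr : k + 1 ≤ r) {lam : Fin r → K}
    (hlam : Function.Injective lam) : (⨅ i, frameIdeal K m (uvec K m (lam i)) k) = siegelIdeal K m k := by
  apply le_antisymm
  · rw [← iInf_frameIdeal_eq_siegelIdeal_succ K m hk hkm (lam := lam ∘ Fin.castLE hkr) (hlam.comp (Fin.castLE_injective hkr))]
    exact le_iInf fun i => iInf_le _ (Fin.castLE hkr i)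
  · exact siegelIdeal_le_iInf_frameIdeal K m lam hk

/-- dimension check: `dim ⋂_{i<r} F_{λ_i}(k) + (k+1)·C(m,k) = C(2m,k)` for any `r ≥ k + 1` distinct slopes (`1 ≤ k`, `2k ≤ m`) — the count of
`finrank_iInf_frameIdeal_add` freezes at `r = k + 1`. -/
theorem finrank_iInf_frameIdeal_add_of_le {k : ℕ} (hk : 1 ≤ k) (hkm : k + k ≤ m) {r : ℕ} (hkr : k + 1 ≤ r) {lam : Fin r → K}
    (hlam : Function.Injective lam) :
    finrank K ↥(⨅ i, frameIdeal K m (uvec K m (lam i)) k) + (k + 1) * m.choose k = (m + m).choose k := by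
  rw [iInf_frameIdeal_eq_siegelIdeal K m hk hkm hkr hlam]
  exact finrank_siegelIdeal K (n := m) k

/-- **KILLING `k + 1` EXPONENTIALS KILLS EVERYTHING**: a degree-`k` form (`1 ≤ k`, `2k ≤ m`) that kills the pure classes
`u^{λ_i}_0 ∧ ⋯ ∧ u^{λ_i}_{m−1}` of `r ≥ k + 1` distinct slopes kills `w_m(q)` for EVERY coefficient sequence `q`. -/
theorem mul_w_eq_zero_of_forall_uprod {k : ℕ} (hk : 1 ≤ k) (hkm : k + k ≤ m) {r : ℕ} (hkr : k + 1 ≤ r) {lam : Fin r → K}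
    (hlam : Function.Injective lam) {θ : HT K (Hankel.In m)} (hθ : θ ∈ Hom K (Hankel.In m) Finset.univ k)
    (h : ∀ i, θ * uprod K m (lam i) m = 0) (q : ℕ → K) : θ * Hankel.w K m m q = 0 := by
  have hmem : θ ∈ ⨅ i, frameIdeal K m (uvec K m (lam i)) k := by
    refine (Submodule.mem_iInf _).mpr fun i => ?_
    rw [← Kr_w_expSeq K m one_ne_zero (lam i) hk, mem_Kr, w_expSeq, one_smul]
    exact ⟨hθ, h i⟩
  rw [iInf_frameIdeal_eq_siegelIdeal K m hk hkm hkr hlam] at hmem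
  exact mul_w_eq_zero_of_mem_siegelIdeal K hmem q

/-- the same as an equivalence (`1 ≤ k`, `2k ≤ m`, `r ≥ k + 1` distinct slopes, `θ` of degree `k`):
**`(∀ i, θ ∧ u^{λ_i}-frame product = 0) ⟺ (∀ q, θ ∧ w_m(q) = 0) ⟺ θ ∈ SI_k`.** -/
theorem forall_mul_uprod_iff_mem_siegelIdeal {k : ℕ} (hk : 1 ≤ k) (hkm : k + k ≤ m) {r : ℕ} (hkr : k + 1 ≤ r) {lam : Fin r → K}
    (hlam : Function.Injective lam) {θ : HT K (Hankel.In m)} (hθ : θ ∈ Hom K (Hankel.In m) Finset.univ k) :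
    (∀ i, θ * uprod K m (lam i) m = 0) ↔ θ ∈ siegelIdeal K m k := by
  constructor
  · intro h
    rw [← iInf_frameIdeal_eq_siegelIdeal K m hk hkm hkr hlam]
    refine (Submodule.mem_iInf _).mpr fun i => ?_
    rw [← Kr_w_expSeq K m one_ne_zero (lam i) hk, mem_Kr, w_expSeq, one_smul]
    exact ⟨hθ, h i⟩
  · intro h i
    have h' := mul_w_eq_zero_of_mem_siegelIdeal K h (expSeq K 1 (lam i))
    rwa [w_expSeq, one_smul] at h'

end Summit.Ventures.HSemireg.Wedge.HankelSecant
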